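import Mathlib.RingTheory.AdicCompletion.Basic
import Mathlib.LinearAlgebra.Basis.Basic
import Mathlib.Tactic.NoncommRing
import HarnessLib

/-!
# Lifting an idempotent in a finite free algebra over an adically complete ring

Let `A` be a commutative ring which is `I`-adically complete and separated (`IsAdicComplete I A`)
and `S` an `A`-algebra — not necessarily commutative — which is free of finite rank as an
`A`-module, with basis `b`.  If `e₀ ∈ S` is idempotent modulo `I • S` (`e₀ * e₀ - e₀ ∈ I • ⊤`),
then there is a genuine idempotent `e ∈ S` with `e - e₀ ∈ I • S`
(`exists_isIdempotentElem_sub_mem_smul_top`).  This is the classical lifting of idempotents over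
complete local rings (Curtis–Reiner, *Methods of Representation Theory* I, (6.7); Lam, *A First
Course in Noncommutative Rings*, (21.31)), proved by the Newton iteration `e ↦ 3e² - 2e³`: if
`e² - e ∈ Iᵐ S` then the next iterate `e'` satisfies `e' - e ∈ Iᵐ S` (`newtonStep_sub_self`) and
`e'² - e' ∈ I²ᵐ S` (`newtonStep_mul_newtonStep_sub`), so the coordinates of the iterates in the
basis `b` are Cauchy sequences of `A`; their limits (`IsPrecomplete`) are the coordinates of an
`e` with `e² - e ∈ ⋂ₘ Iᵐ S`, which is `0` coordinatewise (`IsHausdorff`).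

Also recorded: membership in `I • ⊤` through coordinates in a basis
(`mem_smul_top_iff_forall_repr_mem`), and `I • ⊤ ⊆ S` is a two-sided ideal with
`(I • ⊤)(J • ⊤) ⊆ (I J) • ⊤` (`smul_top_mul_mem`, `mul_mem_smul_top`, `mul_mem_mul_smul_top`).
Used by the Carayol–Serre descent
(`Literature/NumberTheory/GaloisRepresentations/CarayolSerreLemmasProofs.lean`) to lift a
rank-one idempotent of `S ⊗ k₀ ≅ M_n(k₀)` to `S`.  NOT here: lifting of (complete systems of)
orthogonal idempotents, Henselian rings (Mathlib's `HenselianLocalRing` is about roots of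
polynomials in the commutative ring itself).

## References

* C. W. Curtis, I. Reiner, *Methods of Representation Theory* I, Wiley (1981), (6.7).
* T. Y. Lam, *A First Course in Noncommutative Rings*, GTM 131, Springer (1991), Thm. 21.31.
-/

namespace Literature.RingTheory.Idempotents

open Module

/-! ### `I • ⊤` in a free algebra: coordinates, two-sided ideal -/

section SMulTop

variable {A : Type*} [CommRing A]

/-- An element of a free module lies in `I • ⊤` iff all its coordinates lie in `I`. [folklore] -/
theorem mem_smul_top_iff_forall_repr_mem {M : Type*} [AddCommGroup M] [Module A M] {ι : Type*}
    (b : Basis ι A M) (I : Ideal A) (x : M) :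
    x ∈ I • (⊤ : Submodule A M) ↔ ∀ i, b.repr x i ∈ I := by
  rw [← b.span_eq]
  constructor
  · intro hx i
    obtain ⟨a, ha, hax⟩ := (Submodule.mem_ideal_smul_span_iff_exists_sum I b x).mp hx
    have hxa : x = Finsupp.linearCombination A b a := by
      rw [Finsupp.linearCombination_apply]; exact hax.symm
    rw [hxa, b.repr_linearCombination]
    exact ha i
  · intro h
    refine (Submodule.mem_ideal_smul_span_iff_exists_sum I b x).mpr ⟨b.repr x, h, ?_⟩
    rw [← Finsupp.linearCombination_apply]
    exact b.linearCombination_repr x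

variable {S : Type*} [Ring S] [Algebra A S]

/-- `I • S` is stable under right multiplication by `S`. [folklore] -/
theorem smul_top_mul_mem (I : Ideal A) {x : S} (hx : x ∈ I • (⊤ : Submodule A S)) (y : S) :
    x * y ∈ I • (⊤ : Submodule A S) := by
  refine Submodule.smul_induction_on hx (fun r hr n _ => ?_) (fun x₁ x₂ h₁ h₂ => ?_)
  · rw [smul_mul_assoc]; exact Submodule.smul_mem_smul hr Submodule.mem_top
  · rw [add_mul]; exact Submodule.add_mem _ h₁ h₂

/-- `I • S` is stable under left multiplication by `S`. [folklore] -/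
theorem mul_mem_smul_top (I : Ideal A) (y : S) {x : S} (hx : x ∈ I • (⊤ : Submodule A S)) :
    y * x ∈ I • (⊤ : Submodule A S) := by
  refine Submodule.smul_induction_on hx (fun r hr n _ => ?_) (fun x₁ x₂ h₁ h₂ => ?_)
  · rw [mul_smul_comm]; exact Submodule.smul_mem_smul hr Submodule.mem_top
  · rw [mul_add]; exact Submodule.add_mem _ h₁ h₂

/-- `(I • S) (J • S) ⊆ (I J) • S`. [folklore] -/
theorem mul_mem_mul_smul_top (I J : Ideal A) {x y : S} (hx : x ∈ I • (⊤ : Submodule A S))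
    (hy : y ∈ J • (⊤ : Submodule A S)) : x * y ∈ (I * J) • (⊤ : Submodule A S) := by
  refine Submodule.smul_induction_on hx (fun r hr n _ => ?_) (fun x₁ x₂ h₁ h₂ => ?_)
  · rw [smul_mul_assoc, Submodule.mul_smul]
    exact Submodule.smul_mem_smul hr (mul_mem_smul_top J n hy)
  · rw [add_mul]; exact Submodule.add_mem _ h₁ h₂

end SMulTop

/-! ### The Newton step `e ↦ 3e² - 2e³` -/

section Newton

variable {S : Type*} [Ring S]

/-- `e' - e = (1 - 2e)(e² - e)` for the Newton iterate `e' = 3e² - 2e³`. [folklore] -/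
theorem newtonStep_sub_self (e : S) :
    3 * e * e - 2 * e * e * e - e = (1 - 2 * e) * (e * e - e) := by
  noncomm_ring

/-- `e'² - e' = (e² - e)² (4(e² - e) - 3)` for the Newton iterate `e' = 3e² - 2e³`: the defect of
idempotency is squared. [folklore] -/
theorem newtonStep_mul_newtonStep_sub (e : S) :
    (3 * e * e - 2 * e * e * e) * (3 * e * e - 2 * e * e * e) - (3 * e * e - 2 * e * e * e) =
      (e * e - e) * (e * e - e) * (4 * (e * e - e) - 3) := by
  noncomm_ring

end Newton

/-! ### Lifting an idempotent modulo `I • S` -/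

section Lift

variable {A : Type*} [CommRing A] {S : Type*} [Ring S] [Algebra A S] {ι : Type*} [Fintype ι]

/-- **Lifting idempotents over an adically complete ring.**  Let `A` be `I`-adically complete,
`S` an `A`-algebra which is a free `A`-module of finite rank (basis `b`), and `e₀ ∈ S` with
`e₀² - e₀ ∈ I • S`.  Then there is an idempotent `e ∈ S` with `e - e₀ ∈ I • S` (Newton
iteration `e ↦ 3e² - 2e³`, limit taken coordinatewise in `A`).  Curtis–Reiner, *Methods* I,
(6.7); Lam, *First Course*, (21.31). [folklore] -/
theorem exists_isIdempotentElem_sub_mem_smul_top (I : Ideal A) [IsAdicComplete I A]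
    (b : Basis ι A S) (e₀ : S) (he₀ : e₀ * e₀ - e₀ ∈ I • (⊤ : Submodule A S)) :
    ∃ e : S, IsIdempotentElem e ∧ e - e₀ ∈ I • (⊤ : Submodule A S) := by
  classical
  -- the Newton iterates `es m`
  let F : S → S := fun e => 3 * e * e - 2 * e * e * e
  let es : ℕ → S := fun m => F^[m] e₀
  have hes0 : es 0 = e₀ := rfl
  have hess : ∀ m, es (m + 1) = 3 * es m * es m - 2 * es m * es m * es m := fun m =>
    Function.iterate_succ_apply' F m e₀
  -- `es m ^ 2 - es m ∈ I ^ (2 ^ m) • S`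
  have hdef : ∀ m, es m * es m - es m ∈ I ^ (2 ^ m) • (⊤ : Submodule A S) := by
    intro m
    induction m with
    | zero => rw [pow_zero, pow_one]; exact he₀
    | succ m ih =>
      have hI : I ^ (2 ^ (m + 1)) = I ^ (2 ^ m) * I ^ (2 ^ m) := by
        rw [pow_succ, pow_mul, sq]
      rw [hess, newtonStep_mul_newtonStep_sub, hI]
      exact smul_top_mul_mem _ (mul_mem_mul_smul_top _ _ ih ih) _
  -- `es (m + 1) - es m ∈ I ^ (2 ^ m) • S`
  have hstep : ∀ m, es (m + 1) - es m ∈ I ^ (2 ^ m) • (⊤ : Submodule A S) := by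
    intro m
    rw [hess, newtonStep_sub_self]
    exact mul_mem_smul_top _ _ (hdef m)
  -- hence `es M - es m ∈ I ^ m • S` for `m ≤ M`
  have hcauchy : ∀ m M, m ≤ M → es M - es m ∈ I ^ m • (⊤ : Submodule A S) := by
    intro m M hmM
    induction M, hmM using Nat.le_induction with
    | base => rw [sub_self]; exact Submodule.zero_mem _
    | succ M hmM ih =>
      have h1 : es (M + 1) - es M ∈ I ^ m • (⊤ : Submodule A S) :=
        Submodule.smul_mono_left (Ideal.pow_le_pow_right (hmM.trans M.lt_two_pow_self.le))
          (hstep M)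
      have h2 : es (M + 1) - es m = (es (M + 1) - es M) + (es M - es m) := by abel
      rw [h2]
      exact Submodule.add_mem _ h1 ih
  -- the coordinates of the iterates are Cauchy sequences; take their limits
  have hcoord : ∀ i, ∃ L : A, ∀ M, b.repr (es M) i ≡ L [SMOD (I ^ M • ⊤ : Submodule A A)] := by
    intro i
    refine IsPrecomplete.prec' (fun M => b.repr (es M) i) ?_
    intro m M hmM
    have h := (mem_smul_top_iff_forall_repr_mem b (I ^ m) _).mp (hcauchy m M hmM) i
    rw [map_sub, Finsupp.sub_apply] at h
    rw [SModEq.sub_mem, Ideal.smul_eq_mul, Ideal.mul_top, ← neg_sub]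
    exact (I ^ m).neg_mem h
  choose L hL using hcoord
  let e : S := ∑ i, L i • b i
  have herepr : ∀ i, b.repr e i = L i := fun i => congrFun (b.repr_sum_self L) i
  -- `e - es M ∈ I ^ M • S`
  have happrox : ∀ M, e - es M ∈ I ^ M • (⊤ : Submodule A S) := by
    intro M
    refine (mem_smul_top_iff_forall_repr_mem b (I ^ M) _).mpr fun i => ?_
    have h := hL i M
    rw [SModEq.sub_mem, Ideal.smul_eq_mul, Ideal.mul_top] at h
    rw [map_sub, Finsupp.sub_apply, herepr, ← neg_sub]
    exact (I ^ M).neg_mem h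
  -- so `e * e - e ∈ I ^ M • S` for every `M`
  have hee : ∀ M, e * e - e ∈ I ^ M • (⊤ : Submodule A S) := by
    intro M
    have hid : e * e - e =
        e * (e - es M) + (e - es M) * es M - (e - es M) + (es M * es M - es M) := by
      noncomm_ring
    rw [hid]
    refine Submodule.add_mem _ (Submodule.sub_mem _ (Submodule.add_mem _
      (mul_mem_smul_top _ _ (happrox M)) (smul_top_mul_mem _ (happrox M) _)) (happrox M)) ?_
    exact Submodule.smul_mono_left (Ideal.pow_le_pow_right M.lt_two_pow_self.le) (hdef M)
  -- and `e * e = e` by separatedness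
  have hidem : e * e - e = 0 := by
    refine b.ext_elem_iff.mpr fun i => ?_
    rw [map_zero, Finsupp.zero_apply]
    refine IsHausdorff.haus' (I := I) _ fun M => ?_
    rw [SModEq.zero, Ideal.smul_eq_mul, Ideal.mul_top]
    exact (mem_smul_top_iff_forall_repr_mem b (I ^ M) _).mp (hee M) i
  refine ⟨e, sub_eq_zero.mp hidem, ?_⟩
  have h1 : e - e₀ = (e - es 1) + (es 1 - es 0) := by rw [hes0]; abel
  rw [h1]
  refine Submodule.add_mem _ ?_ ?_
  · simpa only [pow_one] using happrox 1
  · simpa only [pow_zero, pow_one] using hstep 0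

end Lift

end Literature.RingTheory.Idempotents
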